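import Summits.QuantumFields.BalabanUV.Beta.D1BFx.GhostKernelSandwich
import Literature.MathematicalPhysics.QuantumFieldTheory.Balaban1983to89.Beta.KernelReflection

/-!
# `BalabanUV.Beta.D1BFx.FineHessianReflection` — road «BF-x» for binder row D1, sub-leaf A4-leg (parity socket): THE (T1-avg) INPUT
# `hinv` OF THE A4 / K-R5 ENDs FROM RELABELLING COVARIANCE OF THE PRIMITIVE DATA (leg, stencils, tables) — an5's `KernelReflection`
# at blocking `1`

HONEST DEPENDENCY (page 1, mandatory): continuum YM on T⁴ ⇐ BetaPertH ∧ nine spine estimates (0/9 proved); BetaPertH ⇐ (D1) ∧ (D4) ∧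
CAP+tail; G-an2-4 gates asym, D1 and NE2/3/4.  HONEST FRAMING (cell contract, verbatim): «discharging `BetaPertH` makes Bałaban's UV
stability UNCONDITIONAL — a real constructive-QFT result; it is NOT the continuum limit and NOT the Clay problem.»  No definition; [folklore]
bookkeeping BY NAME over `KernelReflection.hess_refl` (an5: relabelling invariance of tadpole and bubble) and parts 2–4 of this sub-leaf.
No `def … : Prop`, no citation, no printed statement as hypothesis; 0 binders of the hR root touched; nothing of D1 / BetaPertH discharged.
ABSOLUTE RULE (cell charter, verbatim): «No internally-minted statement may enter as a cited fact. Every hypothesis is either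
kernel-proved in this package or a verbatim quotation of a PUBLISHED theorem with page reference. The manuscript(s) under audit are NOT
citable for their own disputed steps — they are the thing under adjudication; programme-internal (2001/route/tribunal) claims are never
citable.»

WHY (skeleton `HOME/beta/skeletons/D1-b2b-balaban-beta-d1-p2.md` v1.4 node R5, verbatim: «(T1) vanishing first moments for the `μ ≠ ν` channel
(reflection parity of the one-shot system: an5 `KernelReflection`, `bref`/`refK` sockets)»).  The ENDs of this sub-leaf
(`ReducedKernelSandwichLeg/Block.bondSecondMoment_TOfLeg_eq_avgM2_of_inversion(_of_block)`, `GhostKernelSandwich.bondSecondMoment_Pgh_eq_avgM2_of_inversion`)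
take the parity input as a statement about the COMPOSITE kernel: `fineHessA A S Wf κ′ λ′ (a₁ κ′ − s) (a₂ λ′ − s′) = fineHessA A S Wf κ′ λ′ s s′`.
This file reduces it to sockets ON THE DATA, which is what the road's object suppliers (T1 `Ga`, T2 `Ggh`, T4–T6 stencils/tables) can
target: a leg relabelling `Φ : KernelReflection.LegMap 4 F` fixing the leg (`refK Φ A = A`), an inversion-type bond map `u ↦ a κ′ − u`
under which the stencils transform by `σ κ′ • refK Φ` and the tables by `(σ κ′ σ λ′) • refK Φ`, with `σ κ′ · σ λ′ = 1` (all bond signs equal).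
The fine Hessian kernel IS an5's `ExpKernelCalculus.hess` at blocking `1` (`fineHessA_eq_hess`, `ring`), so `hess_refl` applies verbatim.

CONTENT.
* §1 [folklore] `fineHessA_eq_hess`; **`fineHessA_refl`** (general bond map `ρ`, signs `σ`); **`fineHessA_inversion`** (the `hinv` shape).
* §2 [folklore] the diagonal extension inherits a one-bond law: `refK_zero`, `diagExt_refl`.
* §3 [folklore] ENDs WITH REFLECTION SOCKETS: **`bondSecondMoment_TOfLeg_eq_avgM2_of_refl`** (any leg, block-covariant data) and
  **`bondSecondMoment_Pgh_eq_avgM2_of_refl`** (leaf-04's ghost kernel: sockets on `Ggh`, `Sgh`, `ghCnt` only; Ward rows stay).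
NOT HERE: that `Ga`, `Ggh`, the Wilson / averaging / ghost stencils HAVE such relabelling laws (the suppliers' reflection leaves; cf.
`ResolventReflection`, `WilsonStencilReflection` for the bordered family), any Ward row.  Unit `b2b-balaban-beta-d1-formalise-leaf-01` (gen 2).
-/

noncomputable section

namespace Summit.QuantumFields.BalabanUV.Beta.D1BFx.FineHessianReflection

open Finset
open scoped BigOperators
open Literature.MathematicalPhysics.QuantumFieldTheory.Balaban1983to89
open Literature.MathematicalPhysics.QuantumFieldTheory.Balaban1983to89.Beta
open B12Sec2to5 (l1 l1_nonneg)
open ExpKernelCalculus (Site MKer Decays BiLoc VertexFamily VertexFamily₂ hess shiftK)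
open DressedMomentNormalisation (EKer resSite)
open MinimiserIdentityForm (wK)
open KernelReflection (LegMap refK refK_apply hess_refl)
open Summit.QuantumFields.BalabanUV.Beta.TameKernelCalculus
open Summit.QuantumFields.BalabanUV.Beta.D1BFx.GhostLeg (Ggh spr_Ggh shiftK_Ggh_neg)
open Summit.QuantumFields.BalabanUV.Beta.D1BFx.GhostStencil (Sgh ghCnt)
open Summit.QuantumFields.BalabanUV.Beta.D1BFx.ReducedKernelF (TOfLeg)
open Summit.QuantumFields.BalabanUV.Beta.D1BFx.ReducedTableF (tableRedF)
open Summit.QuantumFields.BalabanUV.Beta.D1BFx.GhostKernel (Pgh)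
open Summit.QuantumFields.BalabanUV.Beta.D1BFx.MomentTransferPeriodic (baseKer)
open Summit.QuantumFields.BalabanUV.Beta.D1BFx.MomentTransferPeriodicEntry (avgM2)
open Summit.QuantumFields.BalabanUV.Beta.D1BFx.DressedTablesLeg (bubbleTableA_apply tadpoleTableA_apply)
open Summit.QuantumFields.BalabanUV.Beta.D1BFx.ReducedKernelSandwichLeg (fineHessA fineHessA_apply)
open Summit.QuantumFields.BalabanUV.Beta.D1BFx.ReducedKernelSandwichBlock (diagExt diagExt_apply diagExt_symm
  bondSecondMoment_TOfLeg_eq_avgM2_of_inversion_of_block)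
open Summit.QuantumFields.BalabanUV.Beta.D1BFx.GhostKernelSandwich (ghTab ghTab_apply fineHessGh fineHessGh_eq Pgh_eq_TOfGh_tableRedF
  biLoc_Sgh_one biLoc_diagExt_ghTab Sgh_translate_block diagExt_ghTab_translate)

variable {F : Type*} [Fintype F]

/-! ## §1 The fine Hessian kernel is an5's `hess` at blocking one; its relabelling covariance -/

/-- [folklore] `fineHessA A S Wf κ′ λ′ u u′ = ExpKernelCalculus.hess A S Wf κ′ u λ′ u′` (the same `½·tadpole − ½·bubble`). -/
theorem fineHessA_eq_hess (A : MKer 4 F) (S : Fin 4 → Site 4 → MKer 4 F) (Wf : Fin 4 → Site 4 → Fin 4 → Site 4 → MKer 4 F)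
    (κ' l' : Fin 4) (u u' : Site 4) : fineHessA A S Wf κ' l' u u' = hess A S Wf κ' u l' u' := by
  simp only [fineHessA_apply, tadpoleTableA_apply, bubbleTableA_apply, ExpKernelCalculus.hess]
  ring

variable (A : MKer 4 F) {S : Fin 4 → Site 4 → MKer 4 F} {Wf : Fin 4 → Site 4 → Fin 4 → Site 4 → MKer 4 F} {Cs C2 δ : ℝ}

/-- [folklore] **RELABELLING COVARIANCE OF THE FINE HESSIAN KERNEL** (`KernelReflection.hess_refl` at blocking `1`): a spread leg fixed
by the leg relabelling `Φ` (`refK Φ A = A`), stencils transforming under the bond map `ρ` by `σ κ′ • refK Φ` and tables by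
`(σ κ′ σ λ′) • refK Φ` ⟹ `fineHessA κ′ λ′ (ρ κ′ u) (ρ λ′ u′) = σ κ′ σ λ′ · fineHessA κ′ λ′ u u′`. -/
theorem fineHessA_refl (Φ : LegMap 4 F) (hA : Spr A) (hS : ∀ κ' u, BiLoc (S κ' u) u u Cs δ)
    (hW : ∀ κ' u l' u', BiLoc (Wf κ' u l' u') u u' C2 δ) (hδ : 0 < δ) (hAr : refK Φ A = A)
    (ρ : Fin 4 → Site 4 → Site 4) (σ : Fin 4 → ℝ) (hSr : ∀ κ' u, S κ' (ρ κ' u) = σ κ' • refK Φ (S κ' u))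
    (hWr : ∀ κ' u l' u', Wf κ' (ρ κ' u) l' (ρ l' u') = (σ κ' * σ l') • refK Φ (Wf κ' u l' u'))
    (κ' l' : Fin 4) (u u' : Site 4) :
    fineHessA A S Wf κ' l' (ρ κ' u) (ρ l' u') = σ κ' * σ l' * fineHessA A S Wf κ' l' u u' := by
  obtain ⟨CA, δA, hδA, hAd⟩ := hA
  have hm : 0 < min δA δ := lt_min hδA hδ
  have hAd' : Decays A (|CA|) (min δA δ) := decays_of_le hAd (min_le_left _ _)
  have hV : VertexFamily S 1 (|Cs|) (min δA δ) := fun μ y => by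
    simpa only [Nat.cast_one, one_smul] using biLoc_of_le (hS μ y) (min_le_right δA δ)
  have hW' : VertexFamily₂ Wf 1 (|C2|) (min δA δ) := fun μ y ν y' => by
    simpa only [Nat.cast_one, one_smul] using biLoc_of_le (hW μ y ν y') (min_le_right δA δ)
  rw [fineHessA_eq_hess, fineHessA_eq_hess]
  exact hess_refl Φ hAd' hV hW' hm hAr ρ σ hSr hWr κ' u l' u'

/-- [folklore] **THE (T1-avg) INPUT `hinv` FROM AN INVERSION-TYPE RELABELLING**: bond map `u ↦ a κ′ − u` (offsets may depend on the
direction), all bond signs with `σ κ′ · σ λ′ = 1` ⟹ `fineHessA κ′ λ′ (a κ′ − s) (a λ′ − s′) = fineHessA κ′ λ′ s s′` — literally the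
hypothesis `hinv` (with `a₁ = a₂ = a`) of `…_of_inversion` in parts 2–4. -/
theorem fineHessA_inversion (Φ : LegMap 4 F) (hA : Spr A) (hS : ∀ κ' u, BiLoc (S κ' u) u u Cs δ)
    (hW : ∀ κ' u l' u', BiLoc (Wf κ' u l' u') u u' C2 δ) (hδ : 0 < δ) (hAr : refK Φ A = A)
    (a : Fin 4 → Site 4) (σ : Fin 4 → ℝ) (hσ : ∀ κ' l' : Fin 4, σ κ' * σ l' = 1)
    (hSr : ∀ κ' u, S κ' (a κ' - u) = σ κ' • refK Φ (S κ' u))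
    (hWr : ∀ κ' u l' u', Wf κ' (a κ' - u) l' (a l' - u') = (σ κ' * σ l') • refK Φ (Wf κ' u l' u'))
    (κ' l' : Fin 4) (s s' : Site 4) :
    fineHessA A S Wf κ' l' (a κ' - s) (a l' - s') = fineHessA A S Wf κ' l' s s' := by
  have h := fineHessA_refl A Φ hA hS hW hδ hAr (fun κ u => a κ - u) σ hSr hWr κ' l' s s'
  rw [hσ, one_mul] at h
  exact h

/-! ## §2 The diagonal extension inherits a one-bond relabelling law -/

omit [Fintype F] in
/-- [folklore] The relabelled zero kernel is zero. -/
theorem refK_zero (Φ : LegMap 4 F) : refK Φ (0 : MKer 4 F) = 0 := by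
  funext x z a b
  simp [refK_apply]

omit [Fintype F] in
/-- [folklore] If a ONE-bond table obeys `T κ′ (ρ κ′ u) = refK Φ (T κ′ u)` for a bond map injective in the position (`ρ κ′ u = ρ κ′ u′ → u = u′`),
its diagonal extension obeys the TWO-bond law with signs `σ κ′ σ λ′` for ANY `σ` with `σ κ′ · σ κ′ = 1`. -/
theorem diagExt_refl (Φ : LegMap 4 F) {T : Fin 4 → Site 4 → MKer 4 F} (ρ : Fin 4 → Site 4 → Site 4)
    (hρ : ∀ (κ' : Fin 4) (u u' : Site 4), ρ κ' u = ρ κ' u' → u = u') (σ : Fin 4 → ℝ) (hσ : ∀ κ', σ κ' * σ κ' = 1)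
    (hT : ∀ κ' u, T κ' (ρ κ' u) = refK Φ (T κ' u)) (κ' : Fin 4) (u : Site 4) (l' : Fin 4) (u' : Site 4) :
    diagExt T κ' (ρ κ' u) l' (ρ l' u') = (σ κ' * σ l') • refK Φ (diagExt T κ' u l' u') := by
  unfold diagExt
  by_cases h : κ' = l' ∧ u = u'
  · obtain ⟨h1, h2⟩ := h
    subst h1; subst h2
    rw [if_pos ⟨rfl, rfl⟩, if_pos ⟨rfl, rfl⟩, hσ, one_smul, hT]
  · have h' : ¬(κ' = l' ∧ ρ κ' u = ρ l' u') := by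
      rintro ⟨h1, h2⟩
      subst h1
      exact h ⟨rfl, hρ κ' u u' h2⟩
    rw [if_neg h', if_neg h, refK_zero, smul_zero]

/-! ## §3 The ENDs with reflection sockets in place of `hinv` -/

variable (n : ℕ) [NeZero n] [Nonempty F]

/-- [folklore] **A4 OVER ANY LEG, PARITY FROM RELABELLING SOCKETS** (block-covariant data): as
`ReducedKernelSandwichBlock.bondSecondMoment_TOfLeg_eq_avgM2_of_inversion_of_block`, with `hinv` DISCHARGED by `fineHessA_inversion` from a
leg relabelling fixing `A` and inversion-type stencil/table laws with equal bond signs.  Ward rows `hrow` stay a hypothesis. -/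
theorem bondSecondMoment_TOfLeg_eq_avgM2_of_refl (hA : Spr A) (hAcov : ∀ t : Site 4, shiftK (-((n : ℤ) • t)) A = A)
    (hS : ∀ κ' u, BiLoc (S κ' u) u u Cs δ) (hW : ∀ κ' u l' u', BiLoc (Wf κ' u l' u') u u' C2 δ) (hδ : 0 < δ)
    (hScov : ∀ (κ' : Fin 4) (u t : Site 4), S κ' (u + (n : ℤ) • t) = shiftK (-((n : ℤ) • t)) (S κ' u))
    (hWcov : ∀ (κ' : Fin 4) (u : Site 4) (l' : Fin 4) (u' t : Site 4),
      Wf κ' (u + (n : ℤ) • t) l' (u' + (n : ℤ) • t) = shiftK (-((n : ℤ) • t)) (Wf κ' u l' u'))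
    (hWsymm : ∀ (κ' : Fin 4) (u : Site 4) (l' : Fin 4) (u' : Site 4), Wf κ' u l' u' = Wf l' u' κ' u)
    (hrow : ∀ (κ' l' : Fin 4) (b : Site 4), HasSum (fineHessA A S Wf κ' l' b) 0)
    (Φ : LegMap 4 F) (hAr : refK Φ A = A) (a : Fin 4 → Site 4) (σ : Fin 4 → ℝ) (hσ : ∀ κ' l' : Fin 4, σ κ' * σ l' = 1)
    (hSr : ∀ κ' u, S κ' (a κ' - u) = σ κ' • refK Φ (S κ' u))
    (hWr : ∀ κ' u l' u', Wf κ' (a κ' - u) l' (a l' - u') = (σ κ' * σ l') • refK Φ (Wf κ' u l' u'))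
    (κ lam μ ν : Fin 4) :
    ∑' z : Site 4, ((z κ * z lam : ℤ) : ℝ) * ((n : ℝ) ^ 8 * TOfLeg n A S (tableRedF n Wf) μ ν z)
      = avgM2 n (fineHessA A S Wf μ ν) κ lam :=
  bondSecondMoment_TOfLeg_eq_avgM2_of_inversion_of_block n A hA hAcov hS hW hδ hScov hWcov hWsymm hrow
    (a₁ := a) (a₂ := a) (fineHessA_inversion A Φ hA hS hW hδ hAr a σ hσ hSr hWr) κ lam μ ν

/-- [folklore] **A4 FOR LEAF-04's GHOST KERNEL, PARITY FROM RELABELLING SOCKETS ON `Ggh`, `Sgh`, `ghCnt` ONLY** (`0 < a`): a leg relabelling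
`Φ : LegMap 4 Unit` fixing the ghost leg, an inversion-type bond map `u ↦ c κ′ − u` injective in `u`, under which T6's stencil transforms by
`σ κ′ • refK Φ` (`σ κ′ · σ λ′ = 1`) and the contact table by `refK Φ` ⟹ the coarse bond second moment of `Pgh` is the base-point average of
the fine one, GIVEN only the Ward rows of `fineHessGh`. -/
theorem bondSecondMoment_Pgh_eq_avgM2_of_refl (a cK cQ cW : ℝ) (ha : 0 < a)
    (hrow : ∀ (κ' l' : Fin 4) (b : Site 4), HasSum (fineHessGh n a cK cQ cW κ' l' b) 0)
    (Φ : LegMap 4 Unit) (hAr : refK Φ (Ggh n a) = Ggh n a) (c : Fin 4 → Site 4) (σ : Fin 4 → ℝ)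
    (hσ : ∀ κ' l' : Fin 4, σ κ' * σ l' = 1)
    (hSr : ∀ κ' u, Sgh n cK cQ κ' (c κ' - u) = σ κ' • refK Φ (Sgh n cK cQ κ' u))
    (hTr : ∀ κ' u, ghTab cW κ' (c κ' - u) = refK Φ (ghTab cW κ' u))
    (κ lam μ ν : Fin 4) :
    ∑' z : Site 4, ((z κ * z lam : ℤ) : ℝ) * ((n : ℝ) ^ 8 * Pgh n a cK cQ cW μ ν z)
      = avgM2 n (fineHessGh n a cK cQ cW μ ν) κ lam := by
  have hn : (0 : ℝ) < 1 / (n : ℝ) := div_pos one_pos (by exact_mod_cast Nat.pos_of_ne_zero (NeZero.ne n))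
  have hWr := diagExt_refl Φ (T := ghTab cW) (fun κ u => c κ - u) (fun κ' u u' h => sub_right_injective h) σ (fun κ' => hσ κ' κ') hTr
  rw [Pgh_eq_TOfGh_tableRedF, fineHessGh_eq]
  exact bondSecondMoment_TOfLeg_eq_avgM2_of_refl (Ggh n a) n (spr_Ggh n a ha) (shiftK_Ggh_neg n a ha) (biLoc_Sgh_one n cK cQ)
    (biLoc_diagExt_ghTab n cW) hn (Sgh_translate_block n cK cQ) (diagExt_ghTab_translate n cW)
    (fun κ' u l' u' => diagExt_symm (ghTab cW) κ' u l' u') hrow Φ hAr c σ hσ hSr hWr κ lam μ ν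

end Summit.QuantumFields.BalabanUV.Beta.D1BFx.FineHessianReflection

end
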